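import Summits.QuantumFields.YangMills.Theorems.BalabanUVNodesN05SubBP2DK2KnitGammaPrime
import Literature.MathematicalPhysics.QuantumFieldTheory.Balaban1983to89.B8Prop5ExistsZdLan
import Literature.MathematicalPhysics.QuantumFieldTheory.Balaban1983to89.B8Prop5UniqueZdLan
import Literature.MathematicalPhysics.QuantumFieldTheory.Balaban1983to89.Node00.CarriersB8SubD

/-!
# EDITION «K2» (director-ym №227 (b′-2), plan YMPLAN-G87-N05-GO (R2); dag-n05-d g14, 2026-08-28): this module RE-KEYED onto PRINT's (1.3)–(1.4) CLASS AT THE PINNED BLOCK SIZE —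
# the index `Node00.IdxB8SubD θ` ↦ dag-n05-w1's cut `Node00.IdxB8SubDκ θ Mκ Rκ = {j : IdxB8SubD θ ∕∕ Admissible134 θ.L Mκ Rκ k Ω}` (one more `.1` in every accessor, the new `j.2` =
# the print-class law), and EVERY [Balaban1985BackgroundPropagators]-type binder gains print's literal (1.3)–(1.4) «`Admissible134 θ.L Mκ Rκ i.k i.Ω`» as ONE extra member
# hypothesis right after the (1.5) law (N06 serves ONLY print's class — Q-SG1 «SURVIVES»); extra parameters `(Mκ Rκ : ℕ)`; proof terms = the «P₂D» ones token for token
# (generator `gen_k2.py` on the tree bytes).  The rest of this header is the «P₂D» header VERBATIM.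
# BalabanUVNodes ∕ N05 ([Balaban1985RegularSpaces] Lemma 1 p. 79 – Thm 8 p. 101): THE «P₂C» KNIT WITH PROPOSITION 5 ∃∕! DISCHARGED AT PRINT's `zdLan` FAMILY —
# `BalabanUVNodesN05SubBP2DK2KnitGammaPrime.b8LeafRSC_P2DK2_of_knit_lettersSrc_γ'` with `p5e`∕`p5u` SUPPLIED by this seat's class-free g3 providers
# `B8Prop5ExistsZdLan.prop5Exists_zdLan_of_lettersRD` ∕ `B8Prop5UniqueZdLan.prop5Unique_zdLan_of_lettersUB` from [4]'s letters at the `ZdLanIdx` members — D9c₂C,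
# the token-swap twin of D9c `BalabanUVNodesN05SubBPKnitGammaPrimeZdLan` (p597296): Lemma 1, Thm 2, Prop 3, Thm 4, Prop 5 ∃∕!, PROP 7, Thm 8-surviving all from tree
# theorems; `p6` (Prop. 6 at `c₁` on all `CubeB8` cubes) the ONLY displayed printed member; everything else displayed is N06 content ([4]-type sockets ∕ letters)

EDITION «P₂D» (dag-n05-d g12, 2026-08-28; dag-n05-w1 LOCATED-SLET ∕ p613168, dag-n05-c DESIGN WORD I.30865, dag-n05-w1 `Node00/CarriersB8SubD`): the «P₂C» file of the
same name-stem RE-KEYED onto the (1.5)-obeying admissible sub-index `Node00.IdxB8SubDκ θ Mκ Rκ = {j : IdxB8SubC θ ∕∕ ∀ l < k, ∀ z ∈ Λs k l, Lˡ•z ∈ Lam θ.L Ω l}` — every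
class-wide [Balaban1985BackgroundPropagators]-type binder (`SLet SLetUB SB9P SH59src SB9srcHP` and the produced Prop-5-type families) gains print's (1.5) layer law
«`∀ l, l < i.k → ∀ z ∈ i.Λs i.k l, ((θ.L : ℤ) ^ l) • z ∈ B8ConstraintBonds.Lam θ.L i.Ω l`» as ONE extra member hypothesis right after `DomainSeq θ.L i.Ω` (the member
class of the «P₂C» binders admitted dag-n05-w1's all-`univ` datum `i⋆`, at which `SockLettersRD` is contradictory — p613168 `sLet_idxB8LawsB_unsatisfiable`; with (1.5)
conjoined `i⋆` is excluded, dag-n05-c p613464 `not_lamTop_allUniv`), and the leaf's members are the `IdxB8SubD` ones (accessors `j.1.1.1.1 ↦ j.1.1.1.1.1`, …, the new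
`j.1.2` = the (1.5) law at the member).  Proposition 6's cube family (over `IdxB8SubB`) and the pinned axial map are unchanged.  Proof terms = the «P₂C» ones token for
token.  The rest of this header is the «P₂C» header VERBATIM (read `IdxB8SubD` ∕ the (1.5)-members for `{j : IdxB8SubB θ ∕∕ DomainSeq …}` ∕ the collar law members).

Track A of `YM-PLAN.md` (cell `pub-ymgap`, HUMAN RULING D-0062), node **N05**; seat `pub-ymgap-dag-n05-d` (g11), 2026-08-28; bears on K1⁷ `stmt-QuantumFields-20542`
(`--supports … --as helper`, count-neutral).  THE STORY is told in the sibling `BalabanUVNodesN05SubBP2DK2KnitGammaPrime` (the «P₂C» knit: edition-δ₂ carrier, collar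
sub-family, `B8LeafRSC` with Prop 7 served); THIS FILE is D9c RE-RUN on it (generator `gen_d9c2c.py` on D9c's tree bytes): the Proposition-5 family `zdLan` is CLASS-FREE
and untouched by the re-pin, so the two providers are consumed BY NAME exactly as in D9c; the law-member socket binders carry the `DomainSeq θ.L i.Ω` antecedent, `SB9P`
is `SockB9P3H2`, the sourced Prop-3-frame socket's Hölder line is both-points, and there is NO `p7` binder.

WHAT IS PROVED (composition BY NAME; no estimate; no new definition):
* ★★ **`b8LeafRSC_P2DK2_zdLan_of_knit_lettersSrc_γ'`** — `B8LeafRSC θ.D θ.L λ.C₂ λ.B₁′ λ.inp.B₀′ λ.B₁ λ.B₂ c₁ λ.inp λ.B₀β (530·θ.D·θ.L²) (blockPairNA θ.D θ.L θ.𝔸)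
  (zdGF3HP₂ θ.𝔸 θ.L λ.β λ.len ∘ (·.1.1.1)) (zdLan θ.L λ.B₁ ∘ ι) (cubB8OfRecord θ ∘ (·.1)) (toAxialTowerResid θ λ.β λ.len ∘ (·.1.1))` from D9c's hypotheses with the
  δ₂∕collar tokens and without `p7`: [4]'s letters at the collar law members (`SLet SLetUB`) and at the `zdLan` members (`SLetL SLetLU`), `hfree2`, `SB9P : SockB9P3H2`,
  `SH59src`, `SB9srcHP`, Theorem 8's constants ∕ layer equations ∕ guards, `p6`.
HONEST FRAMING: kernel bookkeeping by name; sockets ∕ letters are HYPOTHESES (N06 content, NOT claimed); `p6` = N05's printed Prop. 6 displayed here (served at the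
print-class cut by the D9d pattern); Prop 7 in the repaired currency `530·D·L²` (weaker than print's `2α₂`, WATCH-P7-CURRENCY-RECORD); count-neutral; **N05 NOT
discharged**; Bałaban AS PRINTED with locators; one finite 𝕋⁴ programme at fixed ε; nothing continuum ∕ ℝ⁴ ∕ OS ∕ mass-gap ∕ Clay.  No `sorry`, no new definition.
Unit `pub-ymgap-dag-n05-d` (g11), 2026-08-28.
[cite: Balaban1985RegularSpaces, Prop. 5 (1.106)–(1.110) p.94, Lemma 1 – Thm 8 pp.79–101, Prop. 7 (1.144)–(1.145) p.100, (1.3)–(1.4) p.77; Balaban1985BackgroundPropagators, Thm 3.1 p.397, Thm 3.3 p.398, (3.40) p.397]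
-/

noncomputable section

namespace Summit.QuantumFields.YangMills.BalabanUVNodes.N05SubBP2DK2KnitGammaPrimeZdLan

open Literature.MathematicalPhysics.QuantumFieldTheory.Balaban1983to89
open Literature.MathematicalPhysics.QuantumFieldTheory.Balaban1983to89.Node00
open Literature.MathematicalPhysics.QuantumFieldTheory.Balaban1983to89.B8Eq134Admissible (Admissible134)
open Literature.MathematicalPhysics.QuantumFieldTheory.Balaban1983to89.B8IdxB8LawsB (IdxB8LawsB IdxB8SubB)
open Literature.MathematicalPhysics.QuantumFieldTheory.Balaban1983to89.B8LeafModelZd (ZdIdx)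
open Literature.MathematicalPhysics.QuantumFieldTheory.Balaban1983to89.B8LeafModelZd3 (SockB9P3)
open Literature.MathematicalPhysics.QuantumFieldTheory.Balaban1983to89.B9SupplySockB9P3ZdGammaUnivDelta2 (SockB9P3H2)
open Literature.MathematicalPhysics.QuantumFieldTheory.Balaban1983to89.B8LeafModelZd3P (zdGF3P zdGF3HP)
open Literature.MathematicalPhysics.QuantumFieldTheory.Balaban1983to89.B8LeafModelZd3P2 (zdGF3P₂ zdGF3HP₂)
open Literature.MathematicalPhysics.QuantumFieldTheory.Balaban1983to89.B8LeafKnitRSC (B8LeafRSC)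
open Literature.MathematicalPhysics.QuantumFieldTheory.Balaban1983to89.B8Prop7TowerAxialRecord (toAxialTowerResid)
open Literature.MathematicalPhysics.QuantumFieldTheory.Balaban1983to89.B8TowerBondsPrinted (towerBondsP)
open Literature.MathematicalPhysics.QuantumFieldTheory.Balaban1983to89.B8SockLettersRD (SockLettersRD)
open Literature.MathematicalPhysics.QuantumFieldTheory.Balaban1983to89.B8Lemma1NonAbelian (mulCfg blockPairNA)
open Literature.MathematicalPhysics.QuantumFieldTheory.Balaban1983to89.B8SockSP5UniformThresholdsSrcGammaPrime (exists_uniform_threshold_sp5_src_γ' exists_uniform_threshold_sp5base_src_γ' exists_uniform_threshold_sp5u_src_γ')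
open Literature.MathematicalPhysics.QuantumFieldTheory.Balaban1983to89.B8LanF146 (LanF146 lanF146_zero_iff)
open Literature.MathematicalPhysics.QuantumFieldTheory.Balaban1983to89.B8Eq138LandauZd (covLap QT InR138 IsLandau146W inR138_zero)
open Summit.QuantumFields.YangMills.BalabanUVNodes.N05SubBP2DK2KnitGammaPrime (b8LeafRSC_P2DK2_of_knit_lettersSrc_γ')
open Literature.MathematicalPhysics.QuantumFieldTheory.Balaban1983to89.B8Prop5LandauDataZd (ZdLanIdx zdLan)
open Literature.MathematicalPhysics.QuantumFieldTheory.Balaban1983to89.B8Prop5ExistsZdLan (prop5Exists_zdLan_of_lettersRD)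
open Literature.MathematicalPhysics.QuantumFieldTheory.Balaban1983to89.B8Prop5UniqueZdLan (prop5Unique_zdLan_of_lettersUB)
open MatrixLog B7Prop1Explicit B7Prop2Explicit B7Prop1Local B7Eq92Concrete
open B8Ineq130 (tlo thi)
open B8Ineq132 (InAk covDerivFwd)
open B7Eq78Linearization (zdBlocking QprimeIter)
open B8Eq119TwistedAxial (bgT Restr129 InAx)
open B8Eq140Level (SideTouches)
open B8Eq1117Concrete (XSpace)
open B8Prop5ContractionKLevel (Bd2)
open B8LambdaSpaceKLevel (wt)
open B8Eq184Proof (gaugeExp cfgExp)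
open B8Eq146AExpansion (iEta plaqCovDeriv)
open B8Eq143PlaqExpansion (pdiv)
open B7Prop4GeneralLevels (linCovIter)
open B8Eq155JBound (Jcur wsup)
open B8ScaledSupNorm (bondNorm msup Bdd msup_le bdd_of_forall)
open B9Eq340HolderZd (hquot AdmPair)

-- `Site` alone could resolve to the torus sites of `Setup.lean`; re-export the `ℤ^d` sites of `B7Prop1Explicit`.
export B7Prop1Explicit (Site)

section KnitP2CZdLan

/-- ★★ **THE «P₂C» KNIT WITH PROPOSITION 5 ∃∕! DISCHARGED AT PRINT's `zdLan` FAMILY** — `B8LeafRSC` over the collar sub-family of the edition-δ₂ carrier whose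
Proposition-5 index is `zdLan θ.L λ.B₁ ∘ ι` for any map `ι` into `Ω 0 = ℤᵈ` `ZdLanIdx` members with antitone regions and towers inside `Ω_j`, given [4]'s letters at
each (existence, RD currency: `SLetL`; uniqueness, guarded: `SLetLU`) and the provider's free-constant condition at half `B₀′`: Prop. 5 ∃ by
`B8Prop5ExistsZdLan.prop5Exists_zdLan_of_lettersRD`, Prop. 5 ! by `B8Prop5UniqueZdLan.prop5Unique_zdLan_of_lettersUB` (this seat's g3 providers BY NAME — class-free),
then `b8LeafRSC_P2DK2_of_knit_lettersSrc_γ'`.  Modulo `p6` only among N05's printed members, and the [4]-type sockets at the collar law members.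
[cite: Balaban1985RegularSpaces, Prop. 5 (1.106)–(1.109) p.94, Lemma 1 – Thm 8 pp.79–101, Prop. 7 (1.145) p.100; Balaban1985BackgroundPropagators, Thm 3.1 p.397, Thm 3.3 p.398] -/
theorem b8LeafRSC_P2DK2_zdLan_of_knit_lettersSrc_γ' {θ : Stage3Params} (lam : ResidB8 θ) (Mκ Rκ : ℕ) (hD : 2 ≤ θ.D)
    {cB9 B₀'H B₂' BG BR cL : ℝ}
    (hC₂eq : lam.C₂ = 2097152 * ((θ.D : ℝ) + 1) ^ 2 * (θ.L : ℝ) ^ 2)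
    (hcB9 : 0 < cB9) (hB₀'H : 0 < B₀'H) (hB₂' : 0 ≤ B₂') (hBG : 0 ≤ BG) (hBR : 0 ≤ BR) (hcL : 0 < cL)
    -- [4]'s letters AT THE `Ω₀ = ℤᵈ` LAW MEMBERS ONLY: existence side (laws on print's domains) and uniqueness side
    (SLet : ∀ i : ZdIdx θ.D θ.L, i.Ω 0 = Set.univ → IdxB8LawsB θ.L i → B8ConstraintBonds.DomainSeq θ.L i.Ω → (∀ l, l < i.k → ∀ z ∈ i.Λs i.k l, ((θ.L : ℤ) ^ l) • z ∈ B8ConstraintBonds.Lam θ.L i.Ω l) → Admissible134 θ.L Mκ Rκ i.k i.Ω → SockLettersRD (𝔸 := θ.𝔸) θ.L BG BR B₀'H B₂' cL i.η i.k i.Ω i.Λs)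
    (SLetUB : ∀ i : ZdIdx θ.D θ.L, i.Ω 0 = Set.univ → IdxB8LawsB θ.L i → B8ConstraintBonds.DomainSeq θ.L i.Ω → (∀ l, l < i.k → ∀ z ∈ i.Λs i.k l, ((θ.L : ℤ) ^ l) • z ∈ B8ConstraintBonds.Lam θ.L i.Ω l) → Admissible134 θ.L Mκ Rκ i.k i.Ω → ∀ α₀ : ℝ, 0 < α₀ → α₀ ≤ cL → ∀ U₀ : Site θ.D → Fin θ.D → θ.𝔸ˣ, (∀ x κ, U₀ x κ ∈ unitaryUnits θ.𝔸) →
      InAk θ.L i.k i.η α₀ i.Ω U₀ →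
      ∃ (g Δ : (Site θ.D → θ.𝔸) →ₗ[ℂ] (Site θ.D → θ.𝔸)) (q : (Site θ.D → θ.𝔸) →ₗ[ℂ] (ℕ → Site θ.D → θ.𝔸))
        (qs : (ℕ → Site θ.D → θ.𝔸) →ₗ[ℂ] (Site θ.D → θ.𝔸)) (Aw c : (ℕ → Site θ.D → θ.𝔸) →ₗ[ℂ] (ℕ → Site θ.D → θ.𝔸))
        (H' : XSpace θ.D i.k θ.𝔸 →ₗ[ℂ] (Site θ.D → θ.𝔸)),
        (∀ x : Site θ.D → θ.𝔸, (∃ C : ℝ, ∀ y, ‖x y‖ ≤ C) → g (Δ x + qs (Aw (q x))) = x) ∧ (∀ φ, qs (c (q (g (g (qs φ))))) = qs φ) ∧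
        (∀ (f : Site θ.D → θ.𝔸), ∀ x ∈ i.Ω 0, Δ f x = covLap i.η U₀ ((i.Ω 0).indicator f) x) ∧
        (∀ (μ : ℕ → Site θ.D → θ.𝔸), ∀ x ∈ i.Ω 0, qs μ x = QT θ.L i.k (i.Λs i.k) U₀ μ x) ∧
        (∀ (f : Site θ.D → θ.𝔸) (n : ℕ), n ≤ i.k → ∀ y ∈ i.Λs i.k n, q f n y = QprimeIter (zdBlocking θ.D θ.L) (bgT θ.L U₀) n f y) ∧
        (∀ (f : Site θ.D → θ.𝔸) (n : ℕ) (y : Site θ.D), ¬ (n ≤ i.k ∧ y ∈ i.Λs i.k n) → q f n y = 0) ∧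
        (∀ (X : XSpace θ.D i.k θ.𝔸) (x : Site θ.D), ‖H' X x‖ ≤ B₀'H * ‖X‖) ∧
        (∀ n, n ≤ i.k → ∀ (X : XSpace θ.D i.k θ.𝔸), ∀ p ∈ {b : Site θ.D × Fin θ.D | SideTouches (i.Ω n) b.1 b.2},
          wt θ.L i.η n * ‖covDerivFwd i.η U₀ p.2 (H' X) p.1‖ ≤ B₀'H * ‖X‖) ∧
        (∀ X : XSpace θ.D i.k θ.𝔸, Bd2 θ.L i.η i.k i.Ω (covLap i.η U₀ (H' X)) (B₂' * ‖X‖)) ∧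
        (∀ (Y : XSpace θ.D i.k θ.𝔸) (n : ℕ) (hn : n ≤ i.k) (y : Site θ.D), y ∈ i.Λs i.k n →
          QprimeIter (zdBlocking θ.D θ.L) (bgT θ.L U₀) n (H' Y) y = Y (⟨n, Nat.lt_succ_of_le hn⟩, y)) ∧
        (∀ (f : Site θ.D → θ.𝔸) (r : ℝ), 0 ≤ r → Bd2 θ.L i.η i.k i.Ω f r →
          (∀ x, ‖g f x‖ ≤ BG * r) ∧ ∀ n, n ≤ i.k → ∀ p ∈ {b : Site θ.D × Fin θ.D | SideTouches (i.Ω n) b.1 b.2},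
            wt θ.L i.η n * ‖covDerivFwd i.η U₀ p.2 (g f) p.1‖ ≤ BG * r) ∧
        (∀ (f : Site θ.D → θ.𝔸) (r : ℝ), 0 ≤ r → Bd2 θ.L i.η i.k i.Ω f r → Bd2 θ.L i.η i.k i.Ω (f - g (qs (c (q (g f))))) (BR * r)))
    -- the SOURCELESS b9 socket of Proposition 3's frame over PRINT's class, at the law members only ([4] Thm 3.3; threshold `cB9`) — for Prop. 3 AS PRINTED
    (SB9P : ∀ i : ZdIdx θ.D θ.L, i.Ω 0 = Set.univ → IdxB8LawsB θ.L i → B8ConstraintBonds.DomainSeq θ.L i.Ω → (∀ l, l < i.k → ∀ z ∈ i.Λs i.k l, ((θ.L : ℤ) ^ l) • z ∈ B8ConstraintBonds.Lam θ.L i.Ω l) →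
      Admissible134 θ.L Mκ Rκ i.k i.Ω →
      SockB9P3H2 (𝔸 := θ.𝔸) θ.L lam.inp.B₀ lam.B₀β cB9 lam.β lam.len i.η i.k i.Ω i.Λs (fun m j => towerBondsP θ.L i.Ω (i.Λs m) j))
    -- PROPOSITION 6 on the record's cube family at `c₁`, PROPOSITION 7 at the P-members — DISPLAYED
    -- the free-constant condition of the Prop.-5 provider (at half `B₀′`)
    (hfree2 : 3 * (2 * (θ.D : ℝ) * (θ.L : ℝ) ^ 2) * BG * BR ≤ lam.inp.B₀' / 2)
    -- PROPOSITION 5's INDEX READ AS OBJECTS: `zdLan` members obeying the member laws, with [4]'s letters at each (RD currency)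
    {J : Type} (ι : J → ZdLanIdx θ.D θ.𝔸)
    (hΩ0L : ∀ a : J, (ι a).Ω 0 = Set.univ) (hΩL : ∀ a : J, ∀ j, (ι a).Ω (j + 1) ⊆ (ι a).Ω j)
    (htowerL : ∀ a : J, ∀ j, j ≤ (ι a).k → ∀ y ∈ (ι a).Λ j, ∀ x, InBox (tlo θ.L y j) (thi θ.L y j) x → x ∈ (ι a).Ω j)
    (SLetL : ∀ a : J, ∀ α₀ : ℝ, 0 < α₀ → α₀ ≤ cL → InAk θ.L (ι a).k (ι a).η α₀ (ι a).Ω (ι a).U₀ →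
      ∃ (g Δ : (Site θ.D → θ.𝔸) →ₗ[ℂ] (Site θ.D → θ.𝔸)) (q : (Site θ.D → θ.𝔸) →ₗ[ℂ] (ℕ → Site θ.D → θ.𝔸))
        (qs : (ℕ → Site θ.D → θ.𝔸) →ₗ[ℂ] (Site θ.D → θ.𝔸)) (Aw c : (ℕ → Site θ.D → θ.𝔸) →ₗ[ℂ] (ℕ → Site θ.D → θ.𝔸))
        (H' : XSpace θ.D (ι a).k θ.𝔸 →ₗ[ℂ] (Site θ.D → θ.𝔸)),
        (∀ x, ∀ y ∈ (ι a).Ω 0, (Δ (g x) + qs (Aw (q (g x)))) y = x y) ∧ (∀ f, q (g (g (qs (c (q f))))) = q f) ∧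
        (∀ (f : Site θ.D → θ.𝔸), ∀ x ∈ (ι a).Ω 0, Δ f x = covLap (ι a).η (ι a).U₀ (((ι a).Ω 0).indicator f) x) ∧
        (∀ (μ : ℕ → Site θ.D → θ.𝔸), ∀ x ∈ (ι a).Ω 0, qs μ x = QT θ.L (ι a).k (ι a).Λ (ι a).U₀ μ x) ∧
        (∀ (f : Site θ.D → θ.𝔸) (j : ℕ), j ≤ (ι a).k → ∀ y ∈ (ι a).Λ j, q f j y = QprimeIter (zdBlocking θ.D θ.L) (bgT θ.L (ι a).U₀) j f y) ∧
        (∀ (X : XSpace θ.D (ι a).k θ.𝔸) (x : Site θ.D), ‖H' X x‖ ≤ B₀'H * ‖X‖) ∧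
        (∀ j, j ≤ (ι a).k → ∀ (X : XSpace θ.D (ι a).k θ.𝔸), ∀ p ∈ {b : Site θ.D × Fin θ.D | SideTouches ((ι a).Ω j) b.1 b.2},
          wt θ.L (ι a).η j * ‖covDerivFwd (ι a).η (ι a).U₀ p.2 (H' X) p.1‖ ≤ B₀'H * ‖X‖) ∧
        (∀ X : XSpace θ.D (ι a).k θ.𝔸, Bd2 θ.L (ι a).η (ι a).k (ι a).Ω (covLap (ι a).η (ι a).U₀ (H' X)) (B₂' * ‖X‖)) ∧
        (∀ (X : XSpace θ.D (ι a).k θ.𝔸) (x : Site θ.D), x ∉ (ι a).Ω 0 → H' X x = 0) ∧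
        (∀ X Y : XSpace θ.D (ι a).k θ.𝔸, (∀ p, Y p = -star (X p)) → ∀ x, H' Y x = -star (H' X x)) ∧
        (∀ (Y : XSpace θ.D (ι a).k θ.𝔸) (j : ℕ) (hj : j ≤ (ι a).k) (y : Site θ.D), y ∈ (ι a).Λ j →
          QprimeIter (zdBlocking θ.D θ.L) (bgT θ.L (ι a).U₀) j (H' Y) y = Y (⟨j, Nat.lt_succ_of_le hj⟩, y)) ∧
        (∀ (f : Site θ.D → θ.𝔸) (r : ℝ), 0 ≤ r → Bd2 θ.L (ι a).η (ι a).k (ι a).Ω f r →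
          (∀ x, ‖g f x‖ ≤ BG * r) ∧ ∀ j, j ≤ (ι a).k → ∀ p ∈ {b : Site θ.D × Fin θ.D | SideTouches ((ι a).Ω j) b.1 b.2},
            wt θ.L (ι a).η j * ‖covDerivFwd (ι a).η (ι a).U₀ p.2 (g f) p.1‖ ≤ BG * r) ∧
        (∀ (f : Site θ.D → θ.𝔸) (x : Site θ.D), x ∉ (ι a).Ω 0 → g f x = 0) ∧
        (∀ f : Site θ.D → θ.𝔸, (∀ j, j ≤ (ι a).k → ∀ x ∈ (ι a).Ω j, IsSelfAdjoint (f x)) → ∀ x, IsSelfAdjoint (g f x)) ∧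
        (∀ (f : Site θ.D → θ.𝔸) (r : ℝ), 0 ≤ r → Bd2 θ.L (ι a).η (ι a).k (ι a).Ω f r →
          Bd2 θ.L (ι a).η (ι a).k (ι a).Ω (f - g (qs (c (q (g f))))) (BR * r)) ∧
        (∀ f : Site θ.D → θ.𝔸, (∀ j, j ≤ (ι a).k → ∀ x ∈ (ι a).Ω j, IsSelfAdjoint (f x)) →
          ∀ j, j ≤ (ι a).k → ∀ x ∈ (ι a).Ω j, IsSelfAdjoint ((f - g (qs (c (q (g f))))) x)))
    -- [4]'s UNIQUENESS letters at the Prop-5 members (left-inverse law of G′ on bounded functions), for Prop. 5's uniqueness clause there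
    (SLetLU : ∀ a : J, ∀ α₀ : ℝ, 0 < α₀ → α₀ ≤ cL → InAk θ.L (ι a).k (ι a).η α₀ (ι a).Ω (ι a).U₀ →
      ∃ (g Δ : (Site θ.D → θ.𝔸) →ₗ[ℂ] (Site θ.D → θ.𝔸)) (q : (Site θ.D → θ.𝔸) →ₗ[ℂ] (ℕ → Site θ.D → θ.𝔸)) (qs : (ℕ → Site θ.D → θ.𝔸) →ₗ[ℂ] (Site θ.D → θ.𝔸))
        (Aw c : (ℕ → Site θ.D → θ.𝔸) →ₗ[ℂ] (ℕ → Site θ.D → θ.𝔸)) (H' : XSpace θ.D (ι a).k θ.𝔸 →ₗ[ℂ] (Site θ.D → θ.𝔸)),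
        (∀ x : Site θ.D → θ.𝔸, (∃ C : ℝ, ∀ y, ‖x y‖ ≤ C) → g (Δ x + qs (Aw (q x))) = x) ∧ (∀ φ, qs (c (q (g (g (qs φ))))) = qs φ) ∧
        (∀ (f : Site θ.D → θ.𝔸), ∀ x ∈ (ι a).Ω 0, Δ f x = covLap (ι a).η (ι a).U₀ (((ι a).Ω 0).indicator f) x) ∧
        (∀ (μ : ℕ → Site θ.D → θ.𝔸), ∀ x ∈ (ι a).Ω 0, qs μ x = QT θ.L (ι a).k (ι a).Λ (ι a).U₀ μ x) ∧
        (∀ (f : Site θ.D → θ.𝔸) (n : ℕ), n ≤ (ι a).k → ∀ y ∈ (ι a).Λ n, q f n y = QprimeIter (zdBlocking θ.D θ.L) (bgT θ.L (ι a).U₀) n f y) ∧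
        (∀ (f : Site θ.D → θ.𝔸) (n : ℕ) (y : Site θ.D), ¬ (n ≤ (ι a).k ∧ y ∈ (ι a).Λ n) → q f n y = 0) ∧
        (∀ (X : XSpace θ.D (ι a).k θ.𝔸) (x : Site θ.D), ‖H' X x‖ ≤ B₀'H * ‖X‖) ∧
        (∀ n, n ≤ (ι a).k → ∀ (X : XSpace θ.D (ι a).k θ.𝔸), ∀ p ∈ {b : Site θ.D × Fin θ.D | SideTouches ((ι a).Ω n) b.1 b.2},
          wt θ.L (ι a).η n * ‖covDerivFwd (ι a).η (ι a).U₀ p.2 (H' X) p.1‖ ≤ B₀'H * ‖X‖) ∧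
        (∀ X : XSpace θ.D (ι a).k θ.𝔸, Bd2 θ.L (ι a).η (ι a).k (ι a).Ω (covLap (ι a).η (ι a).U₀ (H' X)) (B₂' * ‖X‖)) ∧
        (∀ (Y : XSpace θ.D (ι a).k θ.𝔸) (n : ℕ) (hn : n ≤ (ι a).k) (y : Site θ.D), y ∈ (ι a).Λ n →
          QprimeIter (zdBlocking θ.D θ.L) (bgT θ.L (ι a).U₀) n (H' Y) y = Y (⟨n, Nat.lt_succ_of_le hn⟩, y)) ∧
        (∀ (f : Site θ.D → θ.𝔸) (r : ℝ), 0 ≤ r → Bd2 θ.L (ι a).η (ι a).k (ι a).Ω f r →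
          (∀ x, ‖g f x‖ ≤ BG * r) ∧ ∀ n, n ≤ (ι a).k → ∀ p ∈ {b : Site θ.D × Fin θ.D | SideTouches ((ι a).Ω n) b.1 b.2},
            wt θ.L (ι a).η n * ‖covDerivFwd (ι a).η (ι a).U₀ p.2 (g f) p.1‖ ≤ BG * r) ∧
        (∀ (f : Site θ.D → θ.𝔸) (r : ℝ), 0 ≤ r → Bd2 θ.L (ι a).η (ι a).k (ι a).Ω f r →
          Bd2 θ.L (ι a).η (ι a).k (ι a).Ω (f - g (qs (c (q (g f))))) (BR * r)))
    (c₁ : ℝ) (p6 : B8.Prop6Printed θ.D (θ.L : ℝ) lam.B₁ c₁ (fun jB : IdxB8SubB θ => cubB8OfRecord θ jB.1))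
    -- THEOREM 8's CONSTANTS, the layer equations, the sourced free-constant guard, the two SOURCED b9 sockets at the law members
    {c59 cP3 γ₈ γ' γ'' γβ B₈ B₈β : ℝ} (hc59 : 0 < c59) (hcP3 : 0 < cP3) (hγ₈ : 1 ≤ γ₈) (hγ' : 0 ≤ γ') (hγ'' : 0 ≤ γ'')
    (hB : 2 ≤ 5 * (θ.D : ℝ) * θ.L * lam.inp.B₀) (hB₀β : 0 < lam.B₀β) (hB₀8 : lam.inp.B₀ ≤ B₈)
    (hγB : 5 * (θ.D : ℝ) * θ.L * lam.inp.B₀ + 2 * (γ' * lam.inp.B₀) ≤ 5 * (θ.D : ℝ) * θ.L * B₈)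
    (hγB'' : 5 * (θ.D : ℝ) * θ.L * lam.inp.B₀ + 2 * (γ'' * lam.inp.B₀) ≤ 5 * (θ.D : ℝ) * θ.L * B₈)
    (hB8β : 5 * (θ.D : ℝ) * θ.L * lam.B₀β + 2 * lam.B₀β * (γ'' * lam.inp.B₀) + γβ ≤ 5 * (θ.D : ℝ) * θ.L * B₈β)
    (hB₁' : lam.B₁' = 5 * (θ.D : ℝ) * θ.L * B₈)
    (hB₁eq : lam.B₁ = 5 * (θ.D : ℝ) * θ.L * B₈ * (1 + 11 * (θ.D : ℝ) ^ 2)) (hB₂eq : lam.B₂ = 5 * (θ.D : ℝ) * θ.L * B₈β * (1 + 11 * (θ.D : ℝ) ^ 2))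
    (hfreeS : 3 * (2 * (θ.D : ℝ) * (θ.L : ℝ) ^ 2) * BG * BR * (B₈ + γ₈) ≤ lam.inp.B₀' * B₈)
    -- [Balaban1985BackgroundPropagators] Thm 3.3 WITH SOURCE in Theorem 4's frame at (1.146), γ′ letter, threshold `c59`, at the law members ONLY — HYPOTHESIS
    (SH59src : ∀ i : ZdIdx θ.D θ.L, i.Ω 0 = Set.univ → IdxB8LawsB θ.L i → B8ConstraintBonds.DomainSeq θ.L i.Ω → (∀ l, l < i.k → ∀ z ∈ i.Λs i.k l, ((θ.L : ℤ) ^ l) • z ∈ B8ConstraintBonds.Lam θ.L i.Ω l) → Admissible134 θ.L Mκ Rκ i.k i.Ω → ∀ α₀ α₁ : ℝ, 0 < α₀ → 0 < α₁ → α₀ + α₁ ≤ c59 →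
      ∀ U₀ U' : Site θ.D → Fin θ.D → θ.𝔸ˣ, (∀ x κ, U₀ x κ ∈ unitaryUnits θ.𝔸) → (∀ x κ, U' x κ ∈ unitaryUnits θ.𝔸) →
      ∀ φ : Site θ.D → θ.𝔸, ((InR138 θ.L i.k i.η (i.Ω 0) (i.Λs i.k) U₀ φ ∧ (∀ x, IsSelfAdjoint (φ x)) ∧ (∀ x, x ∉ i.Ω 0 → φ x = 0) ∧
          Bdd θ.L i.k i.η (-(2 : ℝ)) (fun j (x : Site θ.D) => x ∈ i.Ω j) φ) ∧
        msup θ.L i.k i.η (-(2 : ℝ)) (fun j (x : Site θ.D) => x ∈ i.Ω j) φ < γ₈ * (α₀ + α₁)) →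
      InAk θ.L i.k i.η α₀ i.Ω U₀ → InAk θ.L i.k i.η α₀ i.Ω (mulCfg U' U₀) → (∀ m, m ≤ i.k → InAx θ.L m (i.Λs m) U₀ (mulCfg U' U₀)) →
      (∀ j, j ≤ i.k → ∀ (z : Site θ.D) (μ : Fin θ.D),
        ((∀ x, InBox (tlo θ.L z j) (thi θ.L z j) x → x ∈ i.Ω j) ∨ (∀ x, InBox (tlo θ.L (z + e μ) j) (thi θ.L (z + e μ) j) x → x ∈ i.Ω j)) →
        ‖(avgIter θ.L (mulCfg U' U₀) j z μ : θ.𝔸) - (avgIter θ.L U₀ j z μ : θ.𝔸)‖ ≤ α₁) →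
      (∀ b ∈ {b : Site θ.D × Fin θ.D | SideTouches (i.Ω 0) b.1 b.2}, ‖((U' b.1 b.2 : θ.𝔸ˣ) : θ.𝔸) - 1‖ ≤ α₁) →
      (∀ m, 1 ≤ m → m ≤ i.k → ∀ (u : Site θ.D → θ.𝔸ˣ) (W : Site θ.D → Fin θ.D → θ.𝔸ˣ) (A' : Site θ.D → Fin θ.D → θ.𝔸),
        (∀ x, u x ∈ unitaryUnits θ.𝔸) → mgauge U₀ u W = U' → Restr129 θ.L m (i.Λs m) U₀ u → LanF146 θ.L i.k i.η (i.Ω 0) i.Λs U₀ φ m W →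
        (∀ y τ, IsSelfAdjoint (A' y τ)) →
        (∀ j, j ≤ m → ∀ y τ, SideTouches (i.Ω j) y τ →
        W y τ = cfgExp i.η A' y τ ∧ ‖A' y τ‖ ≤ (2 * (θ.L * (5 * (θ.D : ℝ) * θ.L * B₈ * (α₀ + α₁))) + 8 * (8 * lam.inp.B₀' * (5 * (θ.D : ℝ) * θ.L * B₈) * (α₀ + α₁))) * ((θ.L : ℝ) ^ j * i.η)⁻¹) →
        (∀ y τ, (∀ j, j ≤ m → ¬ SideTouches (i.Ω j) y τ) → A' y τ = 0) →
        msup θ.L m i.η (-(1 : ℝ)) (fun j (b : Site θ.D × Fin θ.D) => SideTouches (i.Ω j) b.1 b.2) (fun b => A' b.1 b.2)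
        ≤ lam.inp.B₀ * (bondNorm θ.L m i.η (-(3 : ℝ)) i.Ω (fun x μ => Jcur i.η U₀ A' μ x)
        + wsup 1 (fun p : {p : ℕ × (Site θ.D × Fin θ.D) // p.1 ≤ m ∧ p.2 ∈ towerBondsP θ.L i.Ω (i.Λs m) p.1} =>
        linCovIter θ.L U₀ (iEta i.η A') p.1.1 p.1.2.1 p.1.2.2)) + γ' * lam.inp.B₀ * (α₀ + α₁) ∧
        msup θ.L m i.η (-(2 : ℝ)) (fun j (t : Fin θ.D × Fin θ.D × Site θ.D) => SideTouches (i.Ω j) t.2.2 t.2.1)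
        (fun t => covDerivFwd i.η U₀ t.1 (fun z => A' z t.2.1) t.2.2)
        ≤ lam.inp.B₀ * (bondNorm θ.L m i.η (-(3 : ℝ)) i.Ω (fun x μ => Jcur i.η U₀ A' μ x)
        + wsup 1 (fun p : {p : ℕ × (Site θ.D × Fin θ.D) // p.1 ≤ m ∧ p.2 ∈ towerBondsP θ.L i.Ω (i.Λs m) p.1} =>
        linCovIter θ.L U₀ (iEta i.η A') p.1.1 p.1.2.1 p.1.2.2)) + γ' * lam.inp.B₀ * (α₀ + α₁)))
    -- THE SOURCED b9 SOCKET OF PROPOSITION 3's FRAME at the `Ω₀ = ℤᵈ` law members, threshold `cP3`, `|B₁|` over print's class at the top truncation — HYPOTHESIS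
    -- ([Balaban1985BackgroundPropagators] Thm 3.3 with source; = `B8Prop3SrcZd3HPGamma`'s input letter for letter)
    (SB9srcHP : ∀ i : ZdIdx θ.D θ.L, i.Ω 0 = Set.univ → IdxB8LawsB θ.L i → B8ConstraintBonds.DomainSeq θ.L i.Ω → (∀ l, l < i.k → ∀ z ∈ i.Λs i.k l, ((θ.L : ℤ) ^ l) • z ∈ B8ConstraintBonds.Lam θ.L i.Ω l) → Admissible134 θ.L Mκ Rκ i.k i.Ω → ∀ α₀ α₁ α₂ : ℝ, 0 < α₀ → α₀ ≤ cP3 → 0 < α₁ → 0 < α₂ → α₂ ≤ cP3 →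
      ∀ (U₀ W : Site θ.D → Fin θ.D → θ.𝔸ˣ), (∀ x κ, U₀ x κ ∈ unitaryUnits θ.𝔸) → (∀ x κ, W x κ ∈ unitaryUnits θ.𝔸) →
      ∀ f : Site θ.D → θ.𝔸, InR138 θ.L i.k i.η (i.Ω 0) (i.Λs i.k) U₀ f →
      (∀ x, IsSelfAdjoint (f x)) → (∀ x, x ∉ i.Ω 0 → f x = 0) →
      Bdd θ.L i.k i.η (-(2 : ℝ)) (fun j (x : Site θ.D) => x ∈ i.Ω j) f →
      msup θ.L i.k i.η (-(2 : ℝ)) (fun j (x : Site θ.D) => x ∈ i.Ω j) f < γ₈ * (α₀ + α₁) →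
      msup θ.L i.k i.η (-(3 : ℝ)) (fun j (p : Fin θ.D × Site θ.D) => p.2 ∈ i.Ω j) (fun p => covDerivFwd i.η U₀ p.1 f p.2) < γ₈ * (α₀ + α₁) →
      InAk θ.L i.k i.η α₀ i.Ω U₀ → InAk θ.L i.k i.η α₀ i.Ω (mulCfg W U₀) → IsLandau146W θ.L i.k i.η (i.Ω 0) (i.Λs i.k) U₀ f W →
      ∀ A' : Site θ.D → Fin θ.D → θ.𝔸, (∀ y τ, IsSelfAdjoint (A' y τ)) →
      (∀ j, j ≤ i.k → ∀ (y : Site θ.D) (τ : Fin θ.D), SideTouches (i.Ω j) y τ →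
        W y τ = cfgExp i.η A' y τ ∧ ‖A' y τ‖ ≤ α₂ * ((θ.L : ℝ) ^ j * i.η)⁻¹) →
      (∀ (y : Site θ.D) (τ : Fin θ.D), (∀ j, j ≤ i.k → ¬ SideTouches (i.Ω j) y τ) → A' y τ = 0) →
      msup θ.L i.k i.η (-(1 : ℝ)) (fun j (b : Site θ.D × Fin θ.D) => SideTouches (i.Ω j) b.1 b.2) (fun b => A' b.1 b.2)
          ≤ lam.inp.B₀ * (bondNorm θ.L i.k i.η (-(3 : ℝ)) i.Ω (fun x μ => Jcur i.η U₀ A' μ x)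
            + wsup 1 (fun p : {p : ℕ × (Site θ.D × Fin θ.D) // p.1 ≤ i.k ∧ p.2 ∈ towerBondsP θ.L i.Ω (i.Λs i.k) p.1} =>
                linCovIter θ.L U₀ (iEta i.η A') p.1.1 p.1.2.1 p.1.2.2)) + γ'' * lam.inp.B₀ * (α₀ + α₁) ∧
        msup θ.L i.k i.η (-(2 : ℝ)) (fun j (t : Fin θ.D × Fin θ.D × Site θ.D) => SideTouches (i.Ω j) t.2.2 t.2.1)
            (fun t => covDerivFwd i.η U₀ t.1 (fun z => A' z t.2.1) t.2.2)
          ≤ lam.inp.B₀ * (bondNorm θ.L i.k i.η (-(3 : ℝ)) i.Ω (fun x μ => Jcur i.η U₀ A' μ x)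
            + wsup 1 (fun p : {p : ℕ × (Site θ.D × Fin θ.D) // p.1 ≤ i.k ∧ p.2 ∈ towerBondsP θ.L i.Ω (i.Λs i.k) p.1} =>
                linCovIter θ.L U₀ (iEta i.η A') p.1.1 p.1.2.1 p.1.2.2)) + γ'' * lam.inp.B₀ * (α₀ + α₁) ∧
        bondNorm θ.L i.k i.η (-(3 : ℝ)) i.Ω (fun x μ => pdiv i.η U₀ (plaqCovDeriv i.η U₀ A') μ x)
          ≤ lam.inp.B₀ * (bondNorm θ.L i.k i.η (-(3 : ℝ)) i.Ω (fun x μ => Jcur i.η U₀ A' μ x)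
            + wsup 1 (fun p : {p : ℕ × (Site θ.D × Fin θ.D) // p.1 ≤ i.k ∧ p.2 ∈ towerBondsP θ.L i.Ω (i.Λs i.k) p.1} =>
                linCovIter θ.L U₀ (iEta i.η A') p.1.1 p.1.2.1 p.1.2.2)) + γ'' * lam.inp.B₀ * (α₀ + α₁) ∧
        bondNorm θ.L i.k i.η (-(3 : ℝ)) i.Ω (fun x μ => covLap i.η U₀ (fun z => A' z μ) x)
          ≤ lam.inp.B₀ * (bondNorm θ.L i.k i.η (-(3 : ℝ)) i.Ω (fun x μ => Jcur i.η U₀ A' μ x)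
            + wsup 1 (fun p : {p : ℕ × (Site θ.D × Fin θ.D) // p.1 ≤ i.k ∧ p.2 ∈ towerBondsP θ.L i.Ω (i.Λs i.k) p.1} =>
                linCovIter θ.L U₀ (iEta i.η A') p.1.1 p.1.2.1 p.1.2.2)) + γ'' * lam.inp.B₀ * (α₀ + α₁) ∧
        msup θ.L i.k i.η (-(2 + lam.β)) (fun j (q : Fin θ.D × Fin θ.D × (Site θ.D × Site θ.D)) => q.2.2 ∈ AdmPair i.η lam.len ∧ q.2.2.1 ∈ i.Ω j ∧ q.2.2.2 ∈ i.Ω j)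
            (fun q => hquot i.η lam.β lam.len U₀ (covDerivFwd i.η U₀ q.1 (fun z => A' z q.2.1)) q.2.2)
          ≤ lam.B₀β * (bondNorm θ.L i.k i.η (-(3 : ℝ)) i.Ω (fun x μ => Jcur i.η U₀ A' μ x)
            + wsup 1 (fun p : {p : ℕ × (Site θ.D × Fin θ.D) // p.1 ≤ i.k ∧ p.2 ∈ towerBondsP θ.L i.Ω (i.Λs i.k) p.1} =>
                linCovIter θ.L U₀ (iEta i.η A') p.1.1 p.1.2.1 p.1.2.2)) + γβ * (α₀ + α₁)) :
    B8LeafRSC θ.D (θ.L : ℝ) lam.C₂ lam.B₁' lam.inp.B₀' lam.B₁ lam.B₂ c₁ lam.inp lam.B₀β (530 * (θ.D : ℝ) * (θ.L : ℝ) ^ 2) (blockPairNA θ.D θ.L θ.𝔸)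
      (fun j : IdxB8SubDκ θ Mκ Rκ => zdGF3HP₂ θ.𝔸 θ.L lam.β lam.len j.1.1.1.1.1) (fun a : J => zdLan θ.L lam.B₁ (ι a))
      (fun jB : IdxB8SubB θ => cubB8OfRecord θ jB.1) (fun j => toAxialTowerResid θ lam.β lam.len j.1.1.1.1) := by
  -- constants: `2 ≤ 5dLB₀ ≤ 5dLB₈ ≤ λ.B₁`
  have hB₀ : 0 < lam.inp.B₀ := lam.inp.B₀_pos
  have h5 : 0 ≤ 5 * (θ.D : ℝ) * θ.L := by positivity
  have hB₈ : 0 < B₈ := lt_of_lt_of_le hB₀ hB₀8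
  have hD1 : (1 : ℝ) ≤ 1 + 11 * (θ.D : ℝ) ^ 2 := le_add_of_nonneg_right (by positivity)
  have hB₁2 : 2 ≤ lam.B₁ := by
    rw [hB₁eq]
    calc (2 : ℝ) ≤ 5 * (θ.D : ℝ) * θ.L * lam.inp.B₀ := hB
      _ ≤ 5 * (θ.D : ℝ) * θ.L * B₈ := mul_le_mul_of_nonneg_left hB₀8 h5
      _ = 5 * (θ.D : ℝ) * θ.L * B₈ * 1 := (mul_one _).symm
      _ ≤ 5 * (θ.D : ℝ) * θ.L * B₈ * (1 + 11 * (θ.D : ℝ) ^ 2) := mul_le_mul_of_nonneg_left hD1 (by positivity)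
  -- Proposition 5's existence clause at the `zdLan` family, from [4]'s letters there (this seat's provider)
  have p5e : B8.Prop5Exists lam.inp.B₀' lam.B₁ (fun a : J => zdLan θ.L lam.B₁ (ι a)) :=
    prop5Exists_zdLan_of_lettersRD hD θ.two_le_L hB₁2 lam.inp.B₀'_pos hB₀'H hB₂' hBG hBR hcL hfree2 ι hΩL htowerL SLetL
  -- Proposition 5's uniqueness clause at the `zdLan` family, from [4]'s guarded uniqueness letters there (this seat's provider)
  have p5u : B8.Prop5Unique (fun a : J => zdLan θ.L lam.B₁ (ι a)) :=
    prop5Unique_zdLan_of_lettersUB hD θ.two_le_L (le_trans (by norm_num) hB₁2) hB₀'H hB₂' hBG hBR hcL ι hΩ0L hΩL htowerL SLetLU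
  exact b8LeafRSC_P2DK2_of_knit_lettersSrc_γ' lam Mκ Rκ hD hC₂eq hcB9 hB₀'H hB₂' hBG hBR hcL SLet SLetUB SB9P p5e p5u c₁ p6 hc59 hcP3 hγ₈ hγ'
    hγ'' hB hB₀β hB₀8 hγB hγB'' hB8β hB₁' hB₁eq hB₂eq hfreeS SH59src SB9srcHP

end KnitP2CZdLan


end Summit.QuantumFields.YangMills.BalabanUVNodes.N05SubBP2DK2KnitGammaPrimeZdLan

end
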